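/- Free-seat work of WIDTH SEAT 2/3 `ym-line-cbag-p1-w2` (prover-ym-line-cbag-p1-w2-g16-0), route `EguchiKawaiDirectionLadder`
(ideator ym-idea-2, LINE 8), crux `DirectionIncrement` (stmt-QuantumFields-27725), stub B1 `SingleLinkRigidity`: block choice from
centre symmetry, part 2/3 (arc mass under centre symmetry, pigeonhole over shifts, pair counting).  ROUTE-INDEPENDENT.  B1 is NOT
proved here; nothing bears on the YM mass gap. -/
import Summits.QuantumFields.YangMills.Theorems.EguchiKawaiDirectionLadderSingleLinkBlocksCells

/-!
# Stub B1 of crux `DirectionIncrement`, input (BLOCKS), part 2: arc mass, collars, pair counts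

Continuing part 1 (`…SingleLinkBlocksCells`):

* `card_blockLabel_eq_some_le` — ARC MASS under centre symmetry: for unit `d_j`, every arc label `a` has
  `#{j : blockLabel (d j) = some a}·(1 + cos(π/m)) ≤ N + |Σ_j d_j|` (all its points are within `π/m` of the arc centre `ψ_a`, and
  `Σ_j cos(φ_j − ψ_a) = Re(e^{−iψ}Σ d_j) ≤ |Σ d_j|`);
* `exists_shift_few_collars` — PIGEONHOLE: some shift `r < M` has at most `N/M` collar indices (the collar residues partition the indices);
* `pairCount_lower_bounds` — for any labelling with `T` labelled indices and a largest block of size `x₁`, the number `pc` of ordered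
  pairs with different labels satisfies `pc ≥ T(T − x₁)` and `pc ≥ 2x₁(T − x₁)`.

Deterministic and `N`-free.  Barrier-ledger line (`EguchiKawaiBreakdown`); nothing here bears on the Yang–Mills mass gap.
-/

set_option autoImplicit false

noncomputable section

open scoped Real
open Finset

namespace Summit.QuantumFields.YangMills.Theorems.EguchiKawaiDirectionLadder

/-! ### C2. Mass of one arc under centre symmetry -/

/-- Angles in one arc are within `π/m` of its centre: for `blockLabel z = some a` and `w = 2π/(mM)`,
`cos(φ(z) − ψ_a) ≥ cos(π/m)` with `ψ_a = (a·M + r + M/2)·w`. -/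
theorem cos_angleOf_sub_centre_ge {m M r : ℕ} (hm : 0 < m) (hr : r < m * M) {z : ℂ} {a : Fin m}
    (ha : blockLabel m M r z = some a) :
    Real.cos (π / m) ≤ Real.cos (angleOf z - ((a.val * M + r : ℕ) + (M : ℝ) / 2) * (2 * π / (m * M : ℕ))) := by
  obtain ⟨hK, -, hdiv⟩ := blockLabel_eq_some_iff.1 ha
  set K : ℕ := m * M with hKdef
  set c := cellOf K z with hcdef
  set x := relPos m M r c with hxdef
  have hMpos : 0 < M := Nat.pos_of_mul_pos_left hK
  have hKpos : (0 : ℝ) < K := by exact_mod_cast hK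
  set w : ℝ := 2 * π / K with hw
  have hwpos : 0 < w := by positivity
  have hKw : (K : ℝ) * w = 2 * π := by rw [hw]; field_simp
  have hMw : (M : ℝ) * w = 2 * π / m := by
    rw [hw, hKdef]; push_cast; field_simp
  -- position bounds a M ≤ x < a M + M
  have hx1 : a.val * M ≤ x := by rw [← hdiv]; exact Nat.div_mul_le_self x M
  have hx2 : x < a.val * M + M := by rw [← hdiv]; exact Nat.lt_div_mul_add hMpos
  have hcK : c < K := cellOf_lt hK z
  have hqc : (K : ℝ) * ((c + K - r) / K : ℕ) + x = c + K - r := by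
    have h := Nat.div_add_mod (c + K - r) K
    have hr' : r ≤ c + K := by omega
    have : ((K * ((c + K - r) / K) + (c + K - r) % K : ℕ) : ℝ) = ((c + K - r : ℕ) : ℝ) := by rw [h]
    rw [Nat.cast_sub hr'] at this
    push_cast at this ⊢
    rw [hxdef, relPos]
    linarith
  obtain ⟨hφ1, hφ2⟩ := cellOf_mul_le hK z
  set q : ℕ := (c + K - r) / K with hq
  -- the reduced angle
  set v : ℝ := angleOf z - ((a.val * M + r : ℕ) + (M : ℝ) / 2) * w - ((q : ℤ) - 1 : ℤ) * (2 * π) with hv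
  have hcos : Real.cos (angleOf z - ((a.val * M + r : ℕ) + (M : ℝ) / 2) * w) = Real.cos v := by
    rw [hv, Real.cos_sub_int_mul_two_pi]
  rw [hcos]
  have hv' : v = angleOf z - (c : ℝ) * w + ((x : ℝ) - a.val * M) * w - (M : ℝ) * w / 2 := by
    rw [hv, ← hKw]; push_cast
    have : (c : ℝ) = x + r - K + K * q := by linarith
    rw [this]; ring
  have hx1' : (a.val * M : ℝ) ≤ x := by exact_mod_cast hx1
  have hx2' : (x : ℝ) + 1 ≤ a.val * M + M := by exact_mod_cast hx2
  have hvlo : -(π / m) ≤ v := by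
    rw [hv']
    have : (M : ℝ) * w / 2 = π / m := by rw [hMw]; ring
    nlinarith
  have hvhi : v ≤ π / m := by
    rw [hv']
    have : (M : ℝ) * w / 2 = π / m := by rw [hMw]; ring
    have h3 : ((x : ℝ) - a.val * M) * w ≤ (M : ℝ) * w - w := by nlinarith
    nlinarith
  have hπm : π / m ≤ π := div_le_self Real.pi_pos.le (by exact_mod_cast hm)
  rw [← Real.cos_abs v]
  exact Real.cos_le_cos_of_nonneg_of_le_pi (abs_nonneg v) hπm (abs_le.2 ⟨hvlo, hvhi⟩)

/-- **Arc mass bound from centre symmetry**: for unit `d_j` and any arc label `a`,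
`#{j : blockLabel (d j) = some a}·(1 + cos(π/m)) ≤ N + |Σ_j d_j|`. -/
theorem card_blockLabel_eq_some_le {m M r N : ℕ} (hm : 0 < m) (hr : r < m * M) (d : Fin N → ℂ)
    (hd : ∀ j, ‖d j‖ = 1) (a : Fin m) :
    ((Finset.univ.filter fun j => blockLabel m M r (d j) = some a).card : ℝ) * (1 + Real.cos (π / m)) ≤
      N + ‖∑ j, d j‖ := by
  set ψ : ℝ := ((a.val * M + r : ℕ) + (M : ℝ) / 2) * (2 * π / (m * M : ℕ)) with hψ
  set A := Finset.univ.filter fun j => blockLabel m M r (d j) = some a with hA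
  -- Σ_j cos(φ_j − ψ) ≤ |Σ d|
  have hsum : ∑ j, Real.cos (angleOf (d j) - ψ) ≤ ‖∑ j, d j‖ := by
    have h := sum_cos_arg_sub_le_norm_sum d hd (π - ψ)
    refine le_of_eq_of_le ?_ h
    refine Finset.sum_congr rfl fun j _ => ?_
    rw [angleOf, ← Real.cos_neg]; congr 1; ring
  -- split the sum over A and its complement
  have hsplit := Finset.sum_filter_add_sum_filter_not Finset.univ (fun j => blockLabel m M r (d j) = some a)
    (fun j => Real.cos (angleOf (d j) - ψ))
  have hA1 : (A.card : ℝ) * Real.cos (π / m) ≤ ∑ j ∈ A, Real.cos (angleOf (d j) - ψ) := by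
    have h := Finset.card_nsmul_le_sum A (fun j => Real.cos (angleOf (d j) - ψ)) (Real.cos (π / m))
      (fun j hj => cos_angleOf_sub_centre_ge hm hr (Finset.mem_filter.1 hj).2)
    rwa [nsmul_eq_mul] at h
  set B := Finset.univ.filter fun j => ¬ blockLabel m M r (d j) = some a with hB
  have hB1 : -(B.card : ℝ) ≤ ∑ j ∈ B, Real.cos (angleOf (d j) - ψ) := by
    have h := Finset.card_nsmul_le_sum B (fun j => Real.cos (angleOf (d j) - ψ)) (-1)
      (fun j _ => Real.neg_one_le_cos _)
    rw [nsmul_eq_mul, mul_neg_one] at h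
    exact h
  have hcard : (A.card : ℝ) + B.card = N := by
    have h := Finset.card_filter_add_card_filter_not (s := Finset.univ)
      (fun j => blockLabel m M r (d j) = some a)
    rw [Finset.card_univ, Fintype.card_fin] at h
    exact_mod_cast h
  rw [hA] at hA1
  have := hsplit ▸ hsum
  nlinarith [Real.cos_le_one (π / m)]

/-! ### C3. A shift with few collar indices (pigeonhole) -/

/-- A collar label forces the residue of the cell: `blockLabel m M r z = none`, `0 < mM`, `r < M` ⇒ `cellOf (mM) z % M = r`. -/
theorem cellOf_mod_eq_of_blockLabel_eq_none {m M r : ℕ} (hK : 0 < m * M) (hr : r < M) {z : ℂ}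
    (h : blockLabel m M r z = none) : cellOf (m * M) z % M = r := by
  have h' : ¬ (0 < m * M ∧ relPos m M r (cellOf (m * M) z) % M ≠ 0) := by
    intro hc; exact (blockLabel_ne_none_iff.2 hc) h
  rw [not_and, not_not] at h'
  have h0 := h' hK
  set c := cellOf (m * M) z with hc
  have hrK : r ≤ c + m * M := le_trans hr.le (le_trans (Nat.le_mul_of_pos_left M (Nat.pos_of_mul_pos_right hK)) (Nat.le_add_left _ _))
  -- (c + mM - r) % M = 0
  have h1 : (c + m * M - r) % M = 0 := by
    rw [relPos, Nat.mod_mod_of_dvd _ (Dvd.intro_left m rfl)] at h0; exact h0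
  obtain ⟨t, ht⟩ := Nat.dvd_of_mod_eq_zero h1
  have h2 : c + m * M = M * t + r := by omega
  have h3 : c % M = (M * t + r) % M := by
    rw [← h2, Nat.add_mul_mod_self_right]
  rw [h3, Nat.mul_add_mod, Nat.mod_eq_of_lt hr]

/-- **Pigeonhole over shifts**: some shift `r < M` has at most `N/M` collar indices. -/
theorem exists_shift_few_collars {m M N : ℕ} (hK : 0 < m * M) (d : Fin N → ℂ) :
    ∃ r : ℕ, r < M ∧
      ((Finset.univ.filter fun j => blockLabel m M r (d j) = none).card : ℝ) * M ≤ N := by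
  have hMpos : 0 < M := Nat.pos_of_mul_pos_left hK
  -- fibres of j ↦ cell % M
  set f : Fin N → ℕ := fun j => cellOf (m * M) (d j) % M with hf
  have hmaps : ((Finset.univ : Finset (Fin N)) : Set (Fin N)).MapsTo f (Finset.range M) := by
    intro j _; simp only [Finset.coe_range, Set.mem_Iio, hf]; exact Nat.mod_lt _ hMpos
  have hfib := Finset.card_eq_sum_card_fiberwise hmaps
  rw [Finset.card_univ, Fintype.card_fin] at hfib
  -- some fibre has ≤ N/M elements
  by_contra hcon
  push Not at hcon
  have hlt : ∀ r ∈ Finset.range M, (N : ℝ) < ((Finset.univ.filter fun j => f j = r).card : ℝ) * M := by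
    intro r hr
    have h1 := hcon r (Finset.mem_range.1 hr)
    have hsub : (Finset.univ.filter fun j => blockLabel m M r (d j) = none).card ≤
        (Finset.univ.filter fun j => f j = r).card := by
      refine Finset.card_le_card (fun j hj => ?_)
      rw [Finset.mem_filter] at hj ⊢
      exact ⟨hj.1, cellOf_mod_eq_of_blockLabel_eq_none hK (Finset.mem_range.1 hr) hj.2⟩
    have hsub' : ((Finset.univ.filter fun j => blockLabel m M r (d j) = none).card : ℝ) ≤
        ((Finset.univ.filter fun j => f j = r).card : ℝ) := by exact_mod_cast hsub
    have hM0 : (0 : ℝ) ≤ M := by positivity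
    nlinarith
  have hsum : (M : ℝ) * N < ∑ r ∈ Finset.range M, ((Finset.univ.filter fun j => f j = r).card : ℝ) * M := by
    calc (M : ℝ) * N = ∑ r ∈ Finset.range M, (N : ℝ) := by simp
      _ < _ := Finset.sum_lt_sum_of_nonempty ⟨0, Finset.mem_range.2 hMpos⟩ hlt
  rw [← Finset.sum_mul] at hsum
  have : (∑ r ∈ Finset.range M, ((Finset.univ.filter fun j => f j = r).card : ℝ)) = N := by exact_mod_cast hfib.symm
  rw [this] at hsum
  linarith

/-! ### D. Counting pairs across blocks -/

section Counting

variable {N m : ℕ} (ℓ : Fin N → Option (Fin m))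

/-- The number of ordered pairs with different (non-`none`) labels, as a double sum of the per-index partner counts. -/
theorem card_pairs_eq_sum :
    ((Finset.univ.filter fun p : Fin N × Fin N => ℓ p.1 ≠ ℓ p.2 ∧ ℓ p.1 ≠ none ∧ ℓ p.2 ≠ none).card : ℕ) =
      ∑ j, (Finset.univ.filter fun k => ℓ j ≠ ℓ k ∧ ℓ j ≠ none ∧ ℓ k ≠ none).card := by
  rw [Finset.card_filter, ← Finset.univ_product_univ, Finset.sum_product]
  refine Finset.sum_congr rfl fun j _ => ?_
  rw [Finset.card_filter]

/-- Partner count of a labelled index: at least `T − n(ℓ j)` where `T` = number of labelled indices and `n(o)` = size of block `o`. -/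
theorem card_labelled_le_partners_add_block (j : Fin N) (hj : ℓ j ≠ none) :
    (Finset.univ.filter fun k => ℓ k ≠ none).card ≤
      (Finset.univ.filter fun k => ℓ j ≠ ℓ k ∧ ℓ j ≠ none ∧ ℓ k ≠ none).card +
        (Finset.univ.filter fun k => ℓ k = ℓ j).card := by
  refine le_trans (Finset.card_le_card ?_) (Finset.card_union_le _ _)
  intro k hk
  rw [Finset.mem_filter] at hk
  rw [Finset.mem_union, Finset.mem_filter, Finset.mem_filter]
  by_cases h : ℓ k = ℓ j
  · exact Or.inr ⟨hk.1, h⟩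
  · exact Or.inl ⟨hk.1, fun h' => h h'.symm, hj, hk.2⟩

/-- Two different blocks are disjoint subsets of the labelled indices: `n(o) + n(o') ≤ T`. -/
theorem card_block_add_card_block_le {o o' : Option (Fin m)} (ho : o ≠ none) (ho' : o' ≠ none) (hne : o ≠ o') :
    (Finset.univ.filter fun k => ℓ k = o).card + (Finset.univ.filter fun k => ℓ k = o').card ≤
      (Finset.univ.filter fun k => ℓ k ≠ none).card := by
  rw [← Finset.card_union_of_disjoint (Finset.disjoint_filter.2 fun k _ h1 h2 => hne (h1.symm.trans h2))]
  refine Finset.card_le_card fun k hk => ?_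
  rw [Finset.mem_union, Finset.mem_filter, Finset.mem_filter] at hk
  rw [Finset.mem_filter]
  rcases hk with ⟨h1, h2⟩ | ⟨h1, h2⟩
  · exact ⟨h1, h2 ▸ ho⟩
  · exact ⟨h1, h2 ▸ ho'⟩

/-- **The two lower bounds for the pair count** in terms of the number `T` of labelled indices and the size `x₁` of a largest
block `o₁`: `pc ≥ T(T − x₁)` and `pc ≥ 2x₁(T − x₁)`. -/
theorem pairCount_lower_bounds (o₁ : Option (Fin m)) (ho₁ : o₁ ≠ none)
    (hmax : ∀ j, ℓ j ≠ none → (Finset.univ.filter fun k => ℓ k = ℓ j).card ≤ (Finset.univ.filter fun k => ℓ k = o₁).card) :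
    ((Finset.univ.filter fun k => ℓ k ≠ none).card : ℝ) *
        (((Finset.univ.filter fun k => ℓ k ≠ none).card : ℝ) - ((Finset.univ.filter fun k => ℓ k = o₁).card : ℝ)) ≤
        ((Finset.univ.filter fun p : Fin N × Fin N => ℓ p.1 ≠ ℓ p.2 ∧ ℓ p.1 ≠ none ∧ ℓ p.2 ≠ none).card : ℝ) ∧
      2 * ((Finset.univ.filter fun k => ℓ k = o₁).card : ℝ) *
        (((Finset.univ.filter fun k => ℓ k ≠ none).card : ℝ) - ((Finset.univ.filter fun k => ℓ k = o₁).card : ℝ)) ≤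
        ((Finset.univ.filter fun p : Fin N × Fin N => ℓ p.1 ≠ ℓ p.2 ∧ ℓ p.1 ≠ none ∧ ℓ p.2 ≠ none).card : ℝ) := by
  set S := Finset.univ.filter fun k => ℓ k ≠ none with hS
  set B₁ := Finset.univ.filter fun k => ℓ k = o₁ with hB₁
  set P := Finset.univ.filter fun p : Fin N × Fin N => ℓ p.1 ≠ ℓ p.2 ∧ ℓ p.1 ≠ none ∧ ℓ p.2 ≠ none with hP
  set inner : Fin N → ℕ := fun j => (Finset.univ.filter fun k => ℓ j ≠ ℓ k ∧ ℓ j ≠ none ∧ ℓ k ≠ none).card with hinner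
  have hpc : (P.card : ℝ) = ∑ j, (inner j : ℝ) := by
    rw [hP, hinner]; exact_mod_cast card_pairs_eq_sum ℓ
  -- per-index lower bounds
  have hlow1 : ∀ j ∈ S, (S.card : ℝ) - B₁.card ≤ (inner j : ℝ) := by
    intro j hj
    have hj' := (Finset.mem_filter.1 hj).2
    have h1 : (S.card : ℝ) ≤ (inner j : ℝ) + ((Finset.univ.filter fun k => ℓ k = ℓ j).card : ℝ) := by
      rw [hS, hinner]; exact_mod_cast card_labelled_le_partners_add_block ℓ j hj'
    have h2 : ((Finset.univ.filter fun k => ℓ k = ℓ j).card : ℝ) ≤ B₁.card := by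
      rw [hB₁]; exact_mod_cast hmax j hj'
    linarith
  have hlow2 : ∀ j ∈ S, ℓ j ≠ o₁ → (B₁.card : ℝ) ≤ (inner j : ℝ) := by
    intro j hj hne
    have hj' := (Finset.mem_filter.1 hj).2
    have h1 : (S.card : ℝ) ≤ (inner j : ℝ) + ((Finset.univ.filter fun k => ℓ k = ℓ j).card : ℝ) := by
      rw [hS, hinner]; exact_mod_cast card_labelled_le_partners_add_block ℓ j hj'
    have h2 : ((Finset.univ.filter fun k => ℓ k = ℓ j).card : ℝ) + B₁.card ≤ S.card := by
      rw [hB₁, hS]; exact_mod_cast card_block_add_card_block_le ℓ hj' ho₁ hne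
    linarith
  -- the full sum dominates the sum over S
  have hsumS : ∑ j ∈ S, (inner j : ℝ) ≤ P.card := by
    rw [hpc]
    exact Finset.sum_le_sum_of_subset_of_nonneg (Finset.subset_univ S) fun j _ _ => by positivity
  constructor
  · -- LB1
    have h := Finset.card_nsmul_le_sum S (fun j => (inner j : ℝ)) ((S.card : ℝ) - B₁.card) hlow1
    rw [nsmul_eq_mul] at h
    linarith
  · -- LB2: split S by the label o₁
    set S₁ := S.filter fun j => ℓ j = o₁ with hS₁
    set S₂ := S.filter fun j => ¬ ℓ j = o₁ with hS₂
    have hsplit : ∑ j ∈ S, (inner j : ℝ) = ∑ j ∈ S₁, (inner j : ℝ) + ∑ j ∈ S₂, (inner j : ℝ) :=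
      (Finset.sum_filter_add_sum_filter_not S (fun j => ℓ j = o₁) _).symm
    have hS₁eq : S₁ = B₁ := by
      rw [hS₁, hS, hB₁, Finset.filter_filter]
      congr 1
      ext k
      exact ⟨fun h => h.2, fun h => ⟨h ▸ ho₁, h⟩⟩
    have hS₂card : (S₂.card : ℝ) = S.card - B₁.card := by
      have h := Finset.card_filter_add_card_filter_not (s := S) (fun j => ℓ j = o₁)
      have : (S₁.card : ℝ) + S₂.card = S.card := by rw [hS₁, hS₂]; exact_mod_cast h
      rw [hS₁eq] at this
      linarith
    have h1 : (S₁.card : ℝ) * ((S.card : ℝ) - B₁.card) ≤ ∑ j ∈ S₁, (inner j : ℝ) := by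
      have h := Finset.card_nsmul_le_sum S₁ (fun j => (inner j : ℝ)) ((S.card : ℝ) - B₁.card)
        (fun j hj => hlow1 j (Finset.mem_of_mem_filter j hj))
      rwa [nsmul_eq_mul] at h
    have h2 : (S₂.card : ℝ) * B₁.card ≤ ∑ j ∈ S₂, (inner j : ℝ) := by
      have h := Finset.card_nsmul_le_sum S₂ (fun j => (inner j : ℝ)) (B₁.card : ℝ)
        (fun j hj => hlow2 j (Finset.mem_of_mem_filter j hj) (Finset.mem_filter.1 hj).2)
      rwa [nsmul_eq_mul] at h
    rw [hS₁eq] at h1 hsplit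
    rw [hS₂card] at h2
    have h2' : (B₁.card : ℝ) * ((S.card : ℝ) - B₁.card) ≤ ∑ j ∈ S₂, (inner j : ℝ) := by
      rw [mul_comm]; exact h2
    linarith

end Counting

end Summit.QuantumFields.YangMills.Theorems.EguchiKawaiDirectionLadder

end
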